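import Summits.BirchSwinnertonDyer.BirchSwinnertonDyer.Theorems.GenusKolyvaginAtTwoGenusPrimitiveSupplyAtTwoTwistingPrimeEntangledCriterion
import Summits.BirchSwinnertonDyer.BirchSwinnertonDyer.Theorems.GenusKolyvaginAtTwoGenusPrimitiveSupplyAtTwoSupplyDEF1OfDuality
import HarnessLib

/-!
# Route `GenusKolyvaginAtTwo`, crux #2 `GenusPrimitiveSupplyAtTwo` (stmt-BirchSwinnertonDyer-22136):
# EVERY ROW-1 CURVE HAS NON-ENTANGLED MINIMAL PRIME HEEGNER TWINS — the entangled exception never blocks the `∃K`-supply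

Width seat `bsd-line-gk2-p4` g10, cell `bsd-f1-sign2`; helper (`--supports stmt-BirchSwinnertonDyer-22136`), §50 of the twisting-prime series
(after `…TwistingPrimeEntangledCriterion` §48 and `…EntangledSelmerLocal` §49). THEOREMS ONLY: no definition, no named fact beyond the displayed
hypotheses, no `sorry`; no item is closed; BSD is not proved by this.

WHY. The depth-`M` supply of U's auxiliary-field form (g8 p623549 / this seat's `…LevelFourTwin`) produces, for a row-1 curve `W` (`Δ_W < 0`,
`2`-adic tower onto, `#Sel₂(W) = 4`) and a `2`-Selmer-MINIMAL prime Heegner twin `A = W^{(−ℓ₀)}`, Kolyvagin primes of every depth with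
`Sel₂`-trivial even genus twist — PROVIDED the twin is not ENTANGLED (its generator halvable over `ℚ(E[4])`; 2/510 in DES13). By the
ENTANGLEMENT CRITERION (`forall_torsionFixing_four_smul_eq_iff_exists_selmer`) an entangled twin needs a non-zero class of `Sel₂(W)` dying on
`Γ_{ℚ(E[4])}` AND strict at `ℓ₀`; there is at most ONE such class `ξ` (g8 `eq_of_forall_torsionFixing_four_h1Eval_eq_zero`), and gk2-p4 g7's
twisting primes make ANY prescribed non-zero class NON-strict (`exists_twistingPrime_not_mem_strictLocalKer`). Choosing the twisting prime
`ℓ₀` for `ξ` itself (or for any non-zero Selmer class when `W` is Selmer-disentangled) gives at once: `Sel₂(W)` non-strict at `ℓ₀`, hence a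
minimal twin `#Sel₂(A) = 2` (gk2-p5 g8 `GenusKolyTwin.supply_DEF1_of_not_strict_prime_of_duality`, Cor. 3.4 (i) DOWN mod {PT, Tate χ}), and
`A` NOT entangled. Hence:

* `exists_prime_heegnerField_minimalTwin_not_entangled` — beyond every bound a prime `ℓ₀ ≡ 7 (8)` with `K = ℚ(√−ℓ₀)` carrying every K-clause of
  crux 22136 (`2` split, DEF `= 1`) and a globally minimal twin `Wd ≅ W^{(−ℓ₀)}` with `#Sel₂(Wd) = 2` which is NOT ENTANGLED: for every
  `P ∈ Wd(ℚ) ∖ 2Wd(ℚ)` some `h ∈ Γ_{ℚ(E[4])}` moves its half (mod {PT, Tate χ});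
* `exists_prime_heegnerField_minimalTwin_depth_supply_of_cor34i` — … and therefore, for EVERY `M ≥ 1`, the depth-`M` genus-pair supply
  (`ℓ ≡ 7 (8)` Kolyvagin of depth `M`, `#Sel₂ = (2, 1)` for every model) at that twin (mod cor34i, PT, Tate χ; `P ∉ 2Wd(ℚ)` displayed — it
  exists as soon as `rank Wd(ℚ) ≥ 1`, which the line gets from the twin's analytic rank `1`).

NET for the line: the `∃K` form of the depth-`M` supply of U's auxiliary-field form holds for EVERY row-1 curve at EVERY depth with NO
entanglement hypothesis. U itself (odd-twist `2`-primitivity) is untouched; BSD is not proved by this.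

References: [MazurRubin2010] Def. 3.1, Lemma 2.11, Prop. 3.3, Cor. 3.4 (i), Lemma 3.5; [LawsonWuthrich2016] §3; [GrossLMS1991] §3, §9.
-/

set_option linter.dupNamespace false -- tree convention: `Summit.BirchSwinnertonDyer.BirchSwinnertonDyer.Theorems` (summit = sub-problem)
set_option autoImplicit false

noncomputable section

open scoped Classical Pointwise

namespace Summit.BirchSwinnertonDyer.BirchSwinnertonDyer.Theorems.GenusKolyTwistingPrime

open WeierstrassCurve NumberField IsDedekindDomain Field
open Literature.NumberTheory.GaloisRepresentations Literature.NumberTheory.EllipticCurves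
open Literature.NumberTheory Literature.NumberTheory.GaloisCohomology

/-! ## §50 Non-entangled minimal prime Heegner twins exist for every row-1 curve -/

section Disentangled

variable (W : WeierstrassCurve ℚ) [W.IsElliptic] [W.IsGloballyMinimal]

omit [W.IsElliptic] [W.IsGloballyMinimal] in
/-- **A `2`-Selmer group of order `4` has a non-zero class.** [folklore] -/
theorem exists_selmer_ne_zero_of_card_eq_four (h4 : Nat.card (W.selmerGroup 2) = 4) :
    ∃ c ∈ W.selmerGroup 2, c ≠ 0 := by
  by_contra h
  push Not at h
  have : Nat.card (W.selmerGroup 2) = 1 := by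
    rw [(AddSubgroup.eq_bot_iff_forall _).mpr h, AddSubgroup.card_bot]
  omega

omit [W.IsGloballyMinimal] in
/-- **A CANONICAL NON-STRICTNESS TARGET.** For `W/ℚ` elliptic with `ρ̄_{W,2}`, `ρ_{W,4}` onto and `#Sel₂(W) = 4` there is a non-zero class
`c ∈ Sel₂(W)` such that EVERY non-zero class of `Sel₂(W)` dying on `Γ_{ℚ(E[4])}` equals `c` (take `c` = the dying class if there is one —
unique by g8 `eq_of_forall_torsionFixing_four_h1Eval_eq_zero` — else any non-zero class). [cite: LawsonWuthrich2016, §3]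
[cite: GrossLMS1991, §9 Prop. 9.1] -/
theorem exists_selmer_ne_zero_forall_dying_eq (hsurj : W.HasSurjectiveModNGaloisRep 2) (hsurj4 : W.HasSurjectiveModNGaloisRep 4)
    (h4 : Nat.card (W.selmerGroup 2) = 4) :
    ∃ c ∈ W.selmerGroup 2, c ≠ 0 ∧ ∀ y ∈ W.selmerGroup 2, y ≠ 0 →
      (∀ h ∈ torsionFixing W (4 : ℤ), h1Eval W (2 : ℤ) y h = 0) → y = c := by
  by_cases hex : ∃ ξ ∈ W.selmerGroup 2, ξ ≠ 0 ∧ ∀ h ∈ torsionFixing W (4 : ℤ), h1Eval W (2 : ℤ) ξ h = 0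
  · obtain ⟨ξ, hξS, hξ0, hξd⟩ := hex
    exact ⟨ξ, hξS, hξ0, fun y _ hy0 hyd ↦ eq_of_forall_torsionFixing_four_h1Eval_eq_zero W hsurj hsurj4 hy0 hξ0 hyd hξd⟩
  · obtain ⟨c, hcS, hc0⟩ := exists_selmer_ne_zero_of_card_eq_four W h4
    refine ⟨c, hcS, hc0, fun y hyS hy0 hyd ↦ ?_⟩
    exact absurd ⟨y, hyS, hy0, hyd⟩ hex

/-- **EVERY ROW-1 CURVE HAS NON-ENTANGLED MINIMAL PRIME HEEGNER TWINS** (modulo Poitou–Tate duality and Tate's local Euler characteristic,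
the displayed `hPT`, `hEP`). `W/ℚ` globally minimal with `Δ_W < 0`, `ρ̄_{W,2}` and `ρ_{W,4}` onto, `#Sel₂(W) = 4`. Then beyond every bound `b`
there is a prime `ℓ₀ ≡ 7 (mod 8)`, `ℓ₀ ∤ 2N_W`, such that `K = ℚ(√−ℓ₀)` carries every K-clause of crux 22136 (imaginary quadratic, `d_K = −ℓ₀`
odd `≠ −3`, Heegner for `N_W`, the two non-square clauses, `2` split, DEF `= 1`: exactly one root of the `2`-division cubic mod `ℓ₀`) and a
GLOBALLY MINIMAL model `Wd ≅ W^{(−ℓ₀)}` with `#Sel₂(Wd) = 2` which is NOT ENTANGLED: for every rational `P ∈ Wd(ℚ)` with a half `Q` and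
no `Γ`-fixed half (`P ∉ 2Wd(ℚ)`), some `h ∈ Γ_{ℚ(E[4])}` MOVES `Q`. Proof: take `ℓ₀` a twisting prime (g7) at which the canonical class `c`
of `exists_selmer_ne_zero_forall_dying_eq` is NON-strict; the twin is minimal by Cor. 3.4 (i) DOWN (gk2-p5 g8) and non-entangled by the
entanglement criterion (an entangled twin would need a dying Selmer class strict at `ℓ₀`, which could only be `c`).
[cite: MazurRubin2010, Def. 3.1, Lemma 2.11, Prop. 3.3, Cor. 3.4 (i), Lemma 3.5] [cite: LawsonWuthrich2016, §3] [cite: GrossLMS1991, §9] -/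
theorem exists_prime_heegnerField_minimalTwin_not_entangled
    (hPT : poitouTate_selmerStructure_duality_real ℚ)
    (hEP : ∀ v : HeightOneSpectrum (𝓞 ℚ), localEulerPoincareCharacteristic (v.adicCompletion ℚ))
    (hΔ : W.Δ < 0) (hsurj : W.HasSurjectiveModNGaloisRep 2) (hsurj4 : W.HasSurjectiveModNGaloisRep 4)
    (h4 : Nat.card (W.selmerGroup 2) = 4) (b : ℕ) :
    ∃ ℓ₀ : ℕ, ℓ₀.Prime ∧ b < ℓ₀ ∧ ℓ₀ % 8 = 7 ∧ ¬ ℓ₀ ∣ 2 * W.conductorNorm ℤ ∧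
      ∃ (K : Type) (_ : Field K) (_ : NumberField K), IsImaginaryQuadratic K ∧ discr K = -(ℓ₀ : ℤ) ∧ Odd (discr K) ∧
        discr K ≠ -3 ∧ SatisfiesHeegnerHypothesis (W.conductorNorm ℤ) K ∧
        ¬ IsSquare ((discr K : ℚ) * -|W.Δ|) ∧ ¬ IsSquare ((discr K : ℚ) * (-(2 * |W.Δ|))) ∧
        ((Ideal.span {(2 : ℤ)}).primesOver (𝓞 K)).ncard = 2 ∧
        (∃! x : ZMod ℓ₀, 4 * x ^ 3 + ((integralModelInt W).b₂ : ZMod ℓ₀) * x ^ 2 +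
          2 * ((integralModelInt W).b₄ : ZMod ℓ₀) * x + ((integralModelInt W).b₆ : ZMod ℓ₀) = 0) ∧
        ∃ (Wd : WeierstrassCurve ℚ) (_ : Wd.IsElliptic) (_ : Wd.IsGloballyMinimal),
          (∃ C : VariableChange ℚ, C • W.quadraticTwist (discr K : ℚ) = Wd) ∧ Nat.card (Wd.selmerGroup 2) = 2 ∧
          ∀ (P : Wd.toAffine.Point) (Q : geomPoints Wd), (2 : ℤ) • Q = toGeomPoints Wd P →
            (∀ T ∈ geomTorsion Wd (2 : ℤ), Q - T ∉ MulAction.fixedPoints (absoluteGaloisGroup ℚ) (geomPoints Wd)) →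
            ∃ h ∈ torsionFixing W (4 : ℤ), h • Q ≠ Q := by
  have hN : W.conductorNorm ℤ ≠ 0 := (W.conductorNorm_pos_holds).ne'
  obtain ⟨c, hcS, hc0, huniq⟩ := exists_selmer_ne_zero_forall_dying_eq W hsurj hsurj4 h4
  obtain ⟨ℓ, hℓF, hbℓ, hℓN, hℓ8, hℓp, hloc⟩ := exists_twistingPrime_not_mem_strictLocalKer W hsurj hΔ hc0 hN b
  haveI := hℓF
  have hℓ : ℓ.Prime := hℓF.out
  have hns : ¬ W.selmerGroup 2 ≤ MazurRubin2010.strictLocalKer W ℚ_[ℓ] 2 := fun hle ↦ hloc (hle hcS)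
  have hℓN' : ∀ p : ℕ, p.Prime → p ∣ W.conductorNorm ℤ → p ≠ 2 → (ℓ : ZMod p) = -1 := by
    intro p _ hp _
    have h : ((ℓ + 1 : ℕ) : ZMod p) = 0 := (ZMod.natCast_eq_zero_iff _ _).mpr (hℓp p hp)
    rw [Nat.cast_add, Nat.cast_one] at h
    exact eq_neg_of_add_eq_zero_left h
  obtain ⟨K, _, _, hK, hd, hodd, hd3, hH, hsq1, hsq2, h2K, hDEF, Wd, _, _, hWd, hSelWd⟩ :=
    GenusKolyTwin.supply_DEF1_of_not_strict_prime_of_duality W hPT hEP hΔ h4 hℓ8 hℓN' hns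
  refine ⟨ℓ, hℓ, hbℓ, hℓ8, hℓN, K, inferInstance, inferInstance, hK, hd, hodd, hd3, hH, hsq1, hsq2, h2K, hDEF, Wd,
    inferInstance, inferInstance, hWd, hSelWd, fun P Q hQ hP ↦ ?_⟩
  by_contra hcon
  push Not at hcon
  obtain ⟨C, hC⟩ := hWd
  obtain ⟨y, hyS, hy0, hydies, hystr⟩ :=
    (forall_torsionFixing_four_smul_eq_iff_exists_selmer W hΔ hK hodd hH h2K hd hC hSelWd P Q hQ hP).mp hcon
  have hyc : y = c := huniq y hyS hy0 hydies
  rw [hyc] at hystr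
  exact hloc hystr

/-- **… HENCE THE DEPTH-`M` SUPPLY OF THE AUXILIARY-FIELD FORM HOLDS FOR EVERY ROW-1 CURVE, AT EVERY DEPTH, FOR INFINITELY MANY PRIME HEEGNER
FIELDS — with NO entanglement hypothesis.** `W/ℚ` globally minimal, `Δ_W < 0`, `2`-adic tower onto, `#Sel₂(W) = 4`; displayed facts:
cor34i (PRINT), Poitou–Tate duality, Tate's local Euler characteristic. Beyond every bound `b`: a prime Heegner field `K = ℚ(√−ℓ₀)` as in
`exists_prime_heegnerField_minimalTwin_not_entangled` with its globally minimal `2`-Selmer-minimal twin `Wd`, such that for EVERY rational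
`P ∈ Wd(ℚ) ∖ 2Wd(ℚ)` (half `Q`), every `M ≥ 1` and every finite `B₀` there is a prime `ℓ ≡ 7 (mod 8)` outside `B₀`, Kolyvagin for
`(E, K, 2)` of DEPTH `M` (`2^M ∣ ℓ + 1`, `2^M ∣ a_ℓ`), with every model of `W^{(−ℓ)}` having `#Sel₂ = 2` and every model of `Wd^{(−ℓ)}` having
`#Sel₂ = 1` (this seat's `exists_kolyvaginPrime_pow_genusPair_selmer_of_cor34i_of_half_four_of_habitat`). The point `P` exists as soon as
`rank Wd(ℚ) ≥ 1` (the line's twin has analytic rank `1`). U itself is untouched; BSD is not proved by this.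
[cite: MazurRubin2010, Cor. 3.4 (i), Prop. 3.3, Lemma 2.11, Lemma 3.5] [cite: LawsonWuthrich2016, §3] [cite: GrossLMS1991, §3 (3.1)–(3.3), §9] -/
theorem exists_prime_heegnerField_minimalTwin_depth_supply_of_cor34i
    (h34 : MazurRubin2010.cor34i_singleton_rat)
    (hPT : poitouTate_selmerStructure_duality_real ℚ)
    (hEP : ∀ v : HeightOneSpectrum (𝓞 ℚ), localEulerPoincareCharacteristic (v.adicCompletion ℚ))
    (hρ : ∀ n : ℕ, 0 < n → W.HasSurjectiveModNGaloisRep ((2 : ℤ) ^ n)) (hΔ : W.Δ < 0)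
    (h4 : Nat.card (W.selmerGroup 2) = 4) (b : ℕ) :
    ∃ ℓ₀ : ℕ, ℓ₀.Prime ∧ b < ℓ₀ ∧ ℓ₀ % 8 = 7 ∧ ¬ ℓ₀ ∣ 2 * W.conductorNorm ℤ ∧
      ∃ (K : Type) (_ : Field K) (_ : NumberField K), IsImaginaryQuadratic K ∧ discr K = -(ℓ₀ : ℤ) ∧ Odd (discr K) ∧
        discr K ≠ -3 ∧ SatisfiesHeegnerHypothesis (W.conductorNorm ℤ) K ∧
        ¬ IsSquare ((discr K : ℚ) * -|W.Δ|) ∧ ¬ IsSquare ((discr K : ℚ) * (-(2 * |W.Δ|))) ∧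
        ((Ideal.span {(2 : ℤ)}).primesOver (𝓞 K)).ncard = 2 ∧
        ∃ (Wd : WeierstrassCurve ℚ) (_ : Wd.IsElliptic) (_ : Wd.IsGloballyMinimal),
          (∃ C : VariableChange ℚ, C • W.quadraticTwist (discr K : ℚ) = Wd) ∧ Nat.card (Wd.selmerGroup 2) = 2 ∧
          ∀ (P : Wd.toAffine.Point) (Q : geomPoints Wd), (2 : ℤ) • Q = toGeomPoints Wd P →
            (∀ T ∈ geomTorsion Wd (2 : ℤ), Q - T ∉ MulAction.fixedPoints (absoluteGaloisGroup ℚ) (geomPoints Wd)) →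
            ∀ {M : ℕ}, 1 ≤ M → ∀ B₀ : Finset ℕ,
              ∃ ℓ : ℕ, ∃ _ : Fact ℓ.Prime, ℓ ∉ B₀ ∧ ℓ % 8 = 7 ∧ IsKolyvaginPrime (W.conductorNorm ℤ) W K 2 ℓ ∧
                FrobEqFrobInfty W K (2 ^ M) ℓ ∧ 2 ^ M ∣ ℓ + 1 ∧ ((2 : ℤ) ^ M) ∣ W.frobeniusTrace ℓ ∧
                (∀ (W₁ : WeierstrassCurve ℚ) [W₁.IsElliptic],
                  (∃ C₁ : VariableChange ℚ, C₁ • W.quadraticTwist (-(ℓ : ℚ)) = W₁) →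
                    Nat.card (W₁.selmerGroup 2) = 2) ∧
                (∀ (W₂ : WeierstrassCurve ℚ) [W₂.IsElliptic],
                  (∃ C₂ : VariableChange ℚ, C₂ • Wd.quadraticTwist (-(ℓ : ℚ)) = W₂) →
                    Nat.card (W₂.selmerGroup 2) = 1) := by
  have hsurj : W.HasSurjectiveModNGaloisRep 2 := by simpa using hρ 1 one_pos
  have hsurj4 : W.HasSurjectiveModNGaloisRep 4 := by have h := hρ 2 two_pos; norm_num at h; exact h
  obtain ⟨ℓ₀, hℓ₀, hb, hℓ₀8, hℓ₀N, K, _, _, hK, hd, hodd, hd3, hH, hsq1, hsq2, h2K, hDEF, Wd, _, _, hWd, hSelWd, hne⟩ :=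
    exists_prime_heegnerField_minimalTwin_not_entangled W hPT hEP hΔ hsurj hsurj4 h4 b
  refine ⟨ℓ₀, hℓ₀, hb, hℓ₀8, hℓ₀N, K, inferInstance, inferInstance, hK, hd, hodd, hd3, hH, hsq1, hsq2, h2K, Wd,
    inferInstance, inferInstance, hWd, hSelWd, fun P Q hQ hP M hM B₀ ↦ ?_⟩
  obtain ⟨C, hC⟩ := hWd
  exact exists_kolyvaginPrime_pow_genusPair_selmer_of_cor34i_of_half_four_of_habitat W h34 hρ hΔ h4 hK hC hSelWd P Q hQ
    (hne P Q hQ hP) hM B₀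

end Disentangled

end Summit.BirchSwinnertonDyer.BirchSwinnertonDyer.Theorems.GenusKolyTwistingPrime

end
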